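import Summits.QuantumFields.BalabanUV.Beta.GAN24.StaircaseLaplacianDefect
import Summits.QuantumFields.BalabanUV.T4Continuum.Support.BalabanAveragedTowerApply
import Literature.MathematicalPhysics.QuantumFieldTheory.Balaban1983to89.B5DeltaA169

/-!
# G-an2-4 ∕ (CONV-C), road P2, route R2-S1 («intertwining census»), VECTOR LAYER, PART 1 — THE LINE-SUM AVERAGING AGAINST THE STAIRCASE:
# the position-space form of Bałaban's adjoint averaging `Q*_k` ((1.18), line sums) and the EXACT two-level sawtooth
# `(Q*_{RN}B)_μ(x′) − (Q*_N B)_μ(par x′) = π^F_μ(x′)·(B_μ(y) − B_μ(y − e_μ))`, `y = blockOf x′`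

Unit `b2b-balaban-gan24-p2` (gen 29), BINDER row G-an2-4 ∕ (CONV-C), road P2.  The scalar files of this route (`StaircaseLaplacianDefect`,
`SoftMinimiserOneStepSup`, …) use the scalar block mean `Q′`, which intertwines with King's staircase EXACTLY (`Q′_{RN}·J = Q′_N`,
`HardMinimiserOneStepSup.QsOp_mul_stair`).  Bałaban's averaging of VECTOR fields (1.18) is a LINE SUM (`B5Block118.QvOp`,
`lineSum`): a bond field is averaged over the block AND over the straight line of `n` bonds; its adjoint `Q* = n^d·Qᴴ`
(`B5DeltaA169.QvAdj`) spreads a coarse bond value over all lines through a fine bond.  Against the componentwise staircase `J ⊗ 1`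
this is NOT an exact intertwining: THIS FILE computes the defect exactly.
 * §1 **`QvAdj_mulVec_apply`** — THE POSITION-SPACE FORM OF `Q*`: `(Q*B)_μ(x) = (1/n)·Σ_{t<n} B_μ(blockOf(x − t·e_μ))` (each of the `n`
   lines through the bond `(x, μ)` starts `t` steps behind it);
 * §2 step bookkeeping: `blockOf_sub_tstep_n` (`n` fine steps back = one unit block back), `cpt_unitVec`, `par_sub_tstep_mul`
   (`R·s` finer steps back = `s` coarser steps back), **`par_sub_tstep_lt`** (`r < R` finer steps back leave the parent unchanged iff
   `r ≤ rem_μ`, else move it one coarser step back);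
 * §3 **`QvAdj_succ_sub_stair`** — THE SAWTOOTH: for every coarse bond field `B` on the unit lattice, every fine bond `(x′, μ)` of the
   `η∕R`-lattice, `(Q*_{RN}B)_μ(x′) − (Q*_N B)_μ(par x′) = π^F_μ(x′)·(B_μ(y) − B_μ(y − e_μ))` with `y = blockOf_{RN} x′` and the
   first-layer profile `π^F_μ(x′) = −(R − 1 − rem_μ x′)∕(RN)` of `StaircaseLaplacianDefect` — size `≤ (R−1)∕(RN) < η` times a
   unit-lattice backward DIFFERENCE of `B` (divergence form on the unit lattice).
CONSEQUENCE (recorded, not typed here): by duality (`Q = n^{−d}(Q*)ᴴ`, `(J⊗1)ᴴ(J⊗1) = R^d`) the forward defect is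
`Q_{RN}(J⊗1)A − Q_N A = ((R−1)∕(2RN))·∇ᶜ_μ(Q′_N A_μ)` — the mass term `aQ*Q` of Bałaban's `Δ_a` (1.69) has an `O(η)` two-level defect in
divergence form, like the Laplacian's (`LapS_stair_defect`); the vector twin of `SoftMinimiserOneStepSup` consumes both.
HONEST SCOPE.  Exact finite-lattice algebra at `U = 1`, every `d`, `N, R ≥ 1`, every torus `M`; [folklore], kernel-checked, no `sorry`;
nothing of Bałaban's asserted ([Balaban1984PropagatorsI] (1.18) p. 20, (1.69) p. 29 are TEXT LOCATIONS for the objects).  NOT (CONV-C),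
NEVER «G-an2-4 closed», NOT NE2, NOT D1, NOT BetaPertH, NOT continuum, NOT Clay; not in print — our bookkeeping.  HONEST DEPENDENCY:
continuum YM on T⁴ ⇐ BetaPertH ∧ nine spine estimates (0/9 proved); BetaPertH ⇐ (D1) ∧ (D4) ∧ CAP+tail; G-an2-4 gates asym, D1 and NE2/3/4.
-/

noncomputable section

open scoped BigOperators ComplexConjugate Matrix

namespace Summit.QuantumFields.BalabanUV.Beta.GAN24.StaircaseLineSumDefect

open Literature.MathematicalPhysics.QuantumFieldTheory.Balaban1983to89
open B5Prop11Plancherel (Tor fine unitVec)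
open B5Block118 (tstep tstep_zero tstep_succ bpt QvOp bpt_add_tstep)
open B5Blocks16 (blockOf blockOf_bpt bpt_bijective)
open B5DeltaA169 (QvAdj QvAdj_mulVec)
open B5G183RateTorus (cpt)
open B5G183RateTorusW (off)
open Summit.QuantumFields.BalabanUV.T4Continuum.BalabanAveragedTowerModes (par rem cpt_par_add_off_rem par_cpt_add_off
  rem_cpt_add_off val_cpt_add_off)
open Summit.QuantumFields.BalabanUV.T4Continuum.BalabanAveragedTowerApply (tstep_add cpt_sub cpt_add natCast_mul_mod)
open Summit.QuantumFields.BalabanUV.T4Continuum.ScalarPlantingDefect (blockOf_par)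
open Summit.QuantumFields.BalabanUV.Beta.GAN24.StaircaseLaplacianDefect (stair stair_mulVec piF)

variable {d : ℕ}

/-! ## §1 The position-space form of `Q*` -/

section Unit

variable (n : ℕ) [NeZero n] (M : Fin d → ℕ) [hM : ∀ μ, NeZero (M μ)]

/-- a double sum over blocks and offsets of an indicator `[z = n·y + j]` picks the block of `z`. [folklore] -/
theorem sum_sum_ite_eq_bpt (z : Tor (fine n M)) (f : Tor M → ℂ) :
    (∑ y : Tor M, ∑ j : Fin d → Fin n, if z = bpt n M y j then f y else 0) = f (blockOf n M z) := by
  set e := Equiv.ofBijective _ (bpt_bijective n M) with he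
  have h1 : (∑ y : Tor M, ∑ j : Fin d → Fin n, if z = bpt n M y j then f y else 0)
      = ∑ p : Tor M × (Fin d → Fin n), (if z = e p then f p.1 else 0) := by
    rw [Fintype.sum_prod_type]
    rfl
  rw [h1, ← e.symm.sum_comp]
  simp only [Equiv.apply_symm_apply]
  rw [Finset.sum_ite_eq Finset.univ z (fun x => f (e.symm x).1), if_pos (Finset.mem_univ _)]
  rfl

/-- **THE POSITION-SPACE FORM OF `Q*`**: `(Q*B)_μ(x) = (1/n)·Σ_{t<n} B_μ(blockOf(x − t·e_μ))` — the `n` lines of (1.18) through the fine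
bond `(x, μ)` start at the sites `x − t·e_μ`, `t < n`, each contributing the value of `B` on the block of its starting point.
[cite: Balaban1984PropagatorsI, (1.18) p.20] [folklore] -/
theorem QvAdj_mulVec_apply (B : Tor M × Fin d → ℂ) (x : Tor (fine n M)) (μ : Fin d) :
    (QvAdj n M *ᵥ B) (x, μ) = (1 / (n : ℂ)) * ∑ t : Fin n, B (blockOf n M (x - tstep (fine n M) μ t), μ) := by
  have hn : (n : ℂ) ≠ 0 := by exact_mod_cast NeZero.ne n
  have hnd : ((n : ℂ) ^ d) ≠ 0 := pow_ne_zero _ hn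
  rw [QvAdj_mulVec, Pi.smul_apply, smul_eq_mul]
  -- unfold the adjoint kernel
  have hker : ((QvOp n M)ᴴ *ᵥ B) (x, μ)
      = ∑ y : Tor M, (∑ j : Fin d → Fin n, ∑ t : Fin n,
          (if x = bpt n M y j + tstep (fine n M) μ t then (1 / (n : ℂ) ^ (d + 1)) else 0)) * B (y, μ) := by
    simp only [Matrix.mulVec, dotProduct, Matrix.conjTranspose_apply, QvOp]
    rw [Fintype.sum_prod_type]
    refine Finset.sum_congr rfl fun y _ => ?_
    rw [Finset.sum_eq_single μ (fun ν _ hν => by rw [if_neg (Ne.symm hν), star_zero, zero_mul])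
      (fun h => absurd (Finset.mem_univ _) h)]
    rw [if_pos rfl]
    congr 1
    rw [star_sum]
    refine Finset.sum_congr rfl fun j _ => ?_
    rw [star_sum]
    refine Finset.sum_congr rfl fun t _ => ?_
    split_ifs
    · rw [Complex.star_def, map_div₀, map_one, map_pow, Complex.conj_natCast]
    · rw [star_zero]
  rw [hker]
  -- exchange: Σ_y Σ_j Σ_t [x = bpt y j + t e] c B(y) = Σ_t c·B(blockOf(x − t e))
  have hswap : ∑ y : Tor M, (∑ j : Fin d → Fin n, ∑ t : Fin n,
          (if x = bpt n M y j + tstep (fine n M) μ t then (1 / (n : ℂ) ^ (d + 1)) else 0)) * B (y, μ)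
      = ∑ t : Fin n, (1 / (n : ℂ) ^ (d + 1)) * B (blockOf n M (x - tstep (fine n M) μ t), μ) := by
    have e1 : ∀ y : Tor M, (∑ j : Fin d → Fin n, ∑ t : Fin n,
          (if x = bpt n M y j + tstep (fine n M) μ t then (1 / (n : ℂ) ^ (d + 1)) else 0)) * B (y, μ)
        = ∑ t : Fin n, ∑ j : Fin d → Fin n,
          (if x - tstep (fine n M) μ t = bpt n M y j then (1 / (n : ℂ) ^ (d + 1)) * B (y, μ) else 0) := by
      intro y
      rw [Finset.sum_comm, Finset.sum_mul]
      refine Finset.sum_congr rfl fun t _ => ?_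
      rw [Finset.sum_mul]
      refine Finset.sum_congr rfl fun j _ => ?_
      by_cases hc : x = bpt n M y j + tstep (fine n M) μ t
      · rw [if_pos hc, if_pos (sub_eq_iff_eq_add.mpr hc)]
      · rw [if_neg hc, if_neg (fun h => hc (sub_eq_iff_eq_add.mp h)), zero_mul]
    simp_rw [e1]
    rw [Finset.sum_comm]
    refine Finset.sum_congr rfl fun t _ => ?_
    exact sum_sum_ite_eq_bpt n M _ (fun y => (1 / (n : ℂ) ^ (d + 1)) * B (y, μ))
  rw [hswap, ← Finset.mul_sum, ← mul_assoc]
  congr 1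
  field_simp
  ring

/-- **`n` fine steps back = one unit block back**: `blockOf(x − n·e_μ) = blockOf x − e_μ`. [folklore] -/
theorem blockOf_sub_tstep_n (x : Tor (fine n M)) (μ : Fin d) :
    blockOf n M (x - tstep (fine n M) μ n) = blockOf n M x - unitVec M μ := by
  obtain ⟨⟨y, j⟩, rfl⟩ := (bpt_bijective n M).2 x
  dsimp only
  rw [blockOf_bpt]
  have h : bpt n M y j - tstep (fine n M) μ n = bpt n M (y - unitVec M μ) j := by
    rw [sub_eq_iff_eq_add, bpt_add_tstep, sub_add_cancel]
  rw [h, blockOf_bpt]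

end Unit

/-! ## §2 Step bookkeeping at the two-level pairing `η ↔ η/R` -/

section TwoLevel

variable (N R : ℕ) [NeZero N] [NeZero R] (M : Fin d → ℕ) [hM : ∀ μ, NeZero (M μ)]

omit [NeZero N] [NeZero R] hM in
/-- `cpt e_μ = R·e′_μ`: the coarse unit step is `R` fine steps. [folklore] -/
theorem cpt_unitVec (μ : Fin d) : cpt N R M (unitVec (fine N M) μ) = tstep (fine (R * N) M) μ R := by
  funext ν
  simp only [cpt, tstep, unitVec]
  by_cases h : ν = μ
  · subst h
    rw [Pi.single_eq_same, if_pos rfl, ZMod.val_one_eq_one_mod, natCast_mul_mod, mul_one]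
  · rw [Pi.single_eq_of_ne h, if_neg h, ZMod.val_zero, mul_zero, Nat.cast_zero]

/-- **`R·s` finer steps back = `s` coarser steps back**: `par(x′ − (R s)·e′_μ) = par x′ − s·e_μ`. [folklore] -/
theorem par_sub_tstep_mul (x : Tor (fine (R * N) M)) (μ : Fin d) (s : ℕ) :
    par N R M (x - tstep (fine (R * N) M) μ (R * s)) = par N R M x - tstep (fine N M) μ s := by
  -- `x = cpt p + off j`; `(R s) e′ = cpt (s e)`; so `x − (R s)e′ = cpt (p − s e) + off j`
  have hx := cpt_par_add_off_rem N R M x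
  have hstep : tstep (fine (R * N) M) μ (R * s) = cpt N R M (tstep (fine N M) μ s) := by
    funext ν
    simp only [cpt, tstep]
    by_cases h : ν = μ
    · rw [if_pos h, if_pos h, ZMod.val_natCast, natCast_mul_mod]
    · rw [if_neg h, if_neg h, ZMod.val_zero, mul_zero, Nat.cast_zero]
  conv_lhs => rw [← hx, hstep, add_sub_right_comm, ← cpt_sub]
  rw [par_cpt_add_off]

omit [NeZero N] [NeZero R] hM in
/-- the offset vector `off j` minus `r ≤ j_μ` fine steps is the offset vector of the updated digits. [folklore] -/
theorem off_sub_tstep_of_le (j : Fin d → Fin R) (μ : Fin d) {r : ℕ} (hr : r ≤ (j μ : ℕ)) :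
    off N R M j - tstep (fine (R * N) M) μ r
      = off N R M (Function.update j μ ⟨(j μ : ℕ) - r, lt_of_le_of_lt (Nat.sub_le _ _) (j μ).isLt⟩) := by
  funext ν
  simp only [Pi.sub_apply, off, tstep]
  by_cases h : ν = μ
  · subst h
    rw [if_pos rfl, Function.update_self]
    dsimp only
    rw [Nat.cast_sub hr]
  · rw [if_neg h, Function.update_of_ne h, sub_zero]

omit [NeZero N] [NeZero R] hM in
/-- the offset vector `off j` minus `r > j_μ` fine steps (`r < R`) is the offset vector of the updated digits minus one coarse step. [folklore] -/
theorem off_sub_tstep_of_lt (j : Fin d → Fin R) (μ : Fin d) {r : ℕ} (hr : (j μ : ℕ) < r) (hrR : r < R) :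
    off N R M j - tstep (fine (R * N) M) μ r
      = off N R M (Function.update j μ ⟨(j μ : ℕ) + R - r, by omega⟩) - tstep (fine (R * N) M) μ R := by
  funext ν
  simp only [Pi.sub_apply, off, tstep]
  by_cases h : ν = μ
  · subst h
    rw [if_pos rfl, if_pos rfl, Function.update_self]
    dsimp only
    have e : ((j ν : ℕ) + R - r : ℕ) = (j ν : ℕ) + (R - r) := by omega
    rw [e]
    push_cast [Nat.cast_sub hrR.le]
    ring
  · rw [if_neg h, if_neg h, Function.update_of_ne h, sub_zero]

/-- **`r < R` finer steps back**: the parent is unchanged iff `r ≤ rem_μ x′`, else it moves one coarser step back: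
`par(x′ − r·e′_μ) = par x′` if `r ≤ rem_μ x′`, `= par x′ − e_μ` if `rem_μ x′ < r < R`. [folklore] -/
theorem par_sub_tstep_lt (x : Tor (fine (R * N) M)) (μ : Fin d) {r : ℕ} (hrR : r < R) :
    par N R M (x - tstep (fine (R * N) M) μ r)
      = if r ≤ (rem N R M x μ : ℕ) then par N R M x else par N R M x - unitVec (fine N M) μ := by
  have hx := cpt_par_add_off_rem N R M x
  split_ifs with h
  · conv_lhs => rw [← hx, add_sub_assoc, off_sub_tstep_of_le N R M _ μ h]
    rw [par_cpt_add_off]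
  · have h' : (rem N R M x μ : ℕ) < r := not_le.mp h
    conv_lhs => rw [← hx, add_sub_assoc, off_sub_tstep_of_lt N R M _ μ h' hrR, ← add_sub_assoc, add_sub_right_comm,
      ← cpt_unitVec, ← cpt_sub]
    rw [par_cpt_add_off]

/-! ## §3 The sawtooth defect of `Q*` against the staircase -/

omit [NeZero N] [NeZero R] in
/-- **splitting the `RN` finer starting points by coarse step and sub-offset**: `Σ_{t′<RN} g(t′) = Σ_{r<R} Σ_{s<N} g(r + R·s)`. [folklore] -/
theorem sum_fin_mul_eq (g : ℕ → ℂ) : ∑ t' : Fin (R * N), g t' = ∑ r : Fin R, ∑ s : Fin N, g (r + R * s) := by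
  let e : Fin N × Fin R ≃ Fin (R * N) := finProdFinEquiv.trans (finCongr (Nat.mul_comm N R))
  have he : ∀ p : Fin N × Fin R, ((e p : Fin (R * N)) : ℕ) = (p.2 : ℕ) + R * (p.1 : ℕ) := fun p => rfl
  rw [← e.sum_comp (fun t' : Fin (R * N) => g t'), Fintype.sum_prod_type, Finset.sum_comm]
  refine Finset.sum_congr rfl fun r _ => Finset.sum_congr rfl fun s _ => ?_
  rw [he]

/-- **THE SAWTOOTH DEFECT OF `Q*` AGAINST THE STAIRCASE, EXACTLY**: for a coarse bond field `B` on the unit lattice and every fine bond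
`(x′, μ)` of the `η/R`-lattice, `(Q*_{RN}B)_μ(x′) − (Q*_N B)_μ(par x′) = π^F_μ(x′)·(B_μ(y) − B_μ(y − e_μ))`, `y = blockOf_{RN} x′`
(`= blockOf_N(par x′)`), `π^F_μ(x′) = −(R − 1 − rem_μ x′)∕(RN)`. [folklore] -/
theorem QvAdj_succ_sub_stair (B : Tor M × Fin d → ℂ) (x : Tor (fine (R * N) M)) (μ : Fin d) :
    (QvAdj (R * N) M *ᵥ B) (x, μ) - (QvAdj N M *ᵥ B) (par N R M x, μ)
      = piF N R M μ x * (B (blockOf (R * N) M x, μ) - B (blockOf (R * N) M x - unitVec M μ, μ)) := by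
  have hR : 0 < R := Nat.pos_of_ne_zero (NeZero.ne R)
  have hN : 0 < N := Nat.pos_of_ne_zero (NeZero.ne N)
  have hRc : (R : ℂ) ≠ 0 := by exact_mod_cast hR.ne'
  have hNc : (N : ℂ) ≠ 0 := by exact_mod_cast hN.ne'
  have hRNc : ((R * N : ℕ) : ℂ) ≠ 0 := by exact_mod_cast (Nat.mul_pos hR hN).ne'
  set ρ : ℕ := (rem N R M x μ : ℕ) with hρ
  have hρR : ρ < R := (rem N R M x μ).isLt
  -- the coarse line read through `par`: F s = B(blockOf_N(par x − s e), μ)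
  set F : ℕ → ℂ := fun s => B (blockOf N M (par N R M x - tstep (fine N M) μ s), μ) with hF
  have hF0 : F 0 = B (blockOf (R * N) M x, μ) := by
    simp only [hF, tstep_zero, sub_zero, blockOf_par]
  have hFN : F N = B (blockOf (R * N) M x - unitVec M μ, μ) := by
    simp only [hF, blockOf_sub_tstep_n, blockOf_par]
  -- level N: (Q*_N B)(par x) = (1/N) Σ_{s<N} F s
  have hcoarse : (QvAdj N M *ᵥ B) (par N R M x, μ) = (1 / (N : ℂ)) * ∑ s ∈ Finset.range N, F s := by
    rw [QvAdj_mulVec_apply, ← Fin.sum_univ_eq_sum_range]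
  -- level RN: the fine starting point `x − (r + R s)e′` has parent `par x − s e − [r > ρ] e`
  have hfine_term : ∀ (r : Fin R) (s : Fin N),
      B (blockOf (R * N) M (x - tstep (fine (R * N) M) μ ((r : ℕ) + R * (s : ℕ))), μ)
        = if (r : ℕ) ≤ ρ then F s else F (s + 1) := by
    intro r s
    rw [← blockOf_par, tstep_add, ← sub_sub, par_sub_tstep_mul N R M _ μ, par_sub_tstep_lt N R M x μ r.isLt, ← hρ]
    simp only [hF]
    split_ifs with h
    · rfl
    · rw [tstep_succ, ← sub_sub, sub_right_comm]
  have hfine : (QvAdj (R * N) M *ᵥ B) (x, μ)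
      = (1 / ((R * N : ℕ) : ℂ)) * (((ρ : ℂ) + 1) * ∑ s ∈ Finset.range N, F s
          + ((R : ℂ) - 1 - ρ) * ∑ s ∈ Finset.range N, F (s + 1)) := by
    rw [QvAdj_mulVec_apply, sum_fin_mul_eq N R (fun t' => B (blockOf (R * N) M (x - tstep (fine (R * N) M) μ t'), μ))]
    congr 1
    simp_rw [hfine_term]
    -- Σ_r Σ_s (if r ≤ ρ then F s else F (s+1)) = (ρ+1)·ΣF + (R−1−ρ)·ΣF(·+1)
    have hsplit : ∀ r : Fin R, (∑ s : Fin N, if (r : ℕ) ≤ ρ then F s else F (s + 1))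
        = if (r : ℕ) ≤ ρ then ∑ s ∈ Finset.range N, F s else ∑ s ∈ Finset.range N, F (s + 1) := by
      intro r
      split_ifs
      · exact Fin.sum_univ_eq_sum_range F N
      · exact Fin.sum_univ_eq_sum_range (fun s => F (s + 1)) N
    simp_rw [hsplit]
    rw [Finset.sum_ite, Finset.sum_const, Finset.sum_const, nsmul_eq_mul, nsmul_eq_mul]
    have hc1 : ((Finset.univ.filter fun r : Fin R => (r : ℕ) ≤ ρ).card : ℂ) = (ρ : ℂ) + 1 := by
      have : (Finset.univ.filter fun r : Fin R => (r : ℕ) ≤ ρ) = Finset.Iic ⟨ρ, hρR⟩ := by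
        ext r; simp [Fin.le_iff_val_le_val]
      rw [this, Fin.card_Iic]; push_cast; ring
    have hc2 : ((Finset.univ.filter fun r : Fin R => ¬((r : ℕ) ≤ ρ)).card : ℂ) = (R : ℂ) - 1 - ρ := by
      have htot := Finset.card_filter_add_card_filter_not (s := (Finset.univ : Finset (Fin R)))
        (fun r : Fin R => (r : ℕ) ≤ ρ)
      rw [Finset.card_univ, Fintype.card_fin] at htot
      have h1 : ((Finset.univ.filter fun r : Fin R => (r : ℕ) ≤ ρ).card : ℂ)
          + ((Finset.univ.filter fun r : Fin R => ¬((r : ℕ) ≤ ρ)).card : ℂ) = R := by exact_mod_cast htot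
      rw [hc1] at h1
      linear_combination h1
    rw [hc1, hc2]
  -- shift: Σ_{s<N} F(s+1) = Σ_{s<N} F s − F 0 + F N
  have hshift : ∑ s ∈ Finset.range N, F (s + 1) = ∑ s ∈ Finset.range N, F s - F 0 + F N := by
    -- Σ_{s<N+1} F s = Σ_{s<N} F(s+1) + F 0 and = Σ_{s<N} F s + F N
    have h' := Finset.sum_range_succ' F N
    rw [Finset.sum_range_succ] at h'
    linear_combination -h'
  rw [hfine, hcoarse, hshift, hF0, hFN]
  have hρ' : ((R - 1 - ρ : ℕ) : ℂ) = (R : ℂ) - 1 - ρ := by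
    rw [Nat.cast_sub (by omega : ρ ≤ R - 1), Nat.cast_sub hR]; push_cast; ring
  have hpiF : piF N R M μ x = -(((R : ℂ) - 1 - ρ) / ((R : ℂ) * N)) := by
    rw [piF, show (x μ).val % R = ρ from rfl, hρ']; push_cast; ring
  rw [hpiF]
  push_cast
  field_simp
  ring

end TwoLevel

end Summit.QuantumFields.BalabanUV.Beta.GAN24.StaircaseLineSumDefect

end
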